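import Mathlib
import Summits.RiemannHypothesis.RiemannHypothesis.Theorems.IntegerScrewTheoremA
import Summits.RiemannHypothesis.RiemannHypothesis.Theorems.IntegerScrewBracketPoincare
import HarnessLib

/-!
# Route `IntegerScrew` — the brackets of the tilt mixture are scaled window functionals: THEOREM A on the
# sub-windows `(θ, Q]` of the bottom, and the crude two-level bound (CONTINUUM-LIMIT §25.10 (c)–(d), §26.3)

With `H_θ = Σ_{b≤θ}1/b`, `G(θ) = Σ_{b≤θ} g(b)/b`, `Br(θ) = H_θ·G(Q)/H_Q − G(θ)` and
`D_Q(g) = Σ_{x≤Q}(1/x)Σ_{n∣x}Λ(n)(g(x) − g(x/n))²`: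

* `bracket_eq_mul_windowFunctional` — `Br(θ) = (H_θ/H_Q)·(Σ_{θ<x≤Q} g/x − c_θ·G(θ))`, `c_θ = exitMassRatio Q θ`;
* `log_succ_le_sum_Icc_inv` (`log(Q+1) ≤ H_Q`), `log_succ_le_log_add_inv` (`log(θ+1) ≤ log θ + 1/θ`);
* **`bracket_sq_le_theoremA`** — `149 ≤ θ`, `2θ ≤ Q` ⊢ `Br(θ)² ≤ 304500·(log Q/log(θ+1))·D_Q(g)`
  (`IntegerScrewTheoremA.theoremA` on the window `(θ, Q]`; after the scaling `(H_θ/H_Q)²` the window constant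
  `X²` becomes `O(1)`; the stated `X¹` form is what `IntegerScrewTiltPricing` consumes);
* **`bracket_sq_le_crude`** — `149 ≤ Q`, `1 ≤ θ ≤ Q` ⊢ `Br(θ)² ≤ (33 log Q)²·D_Q(g)`
  (`IntegerScrewBracketPoincare.bracket_sq_le_dirichlet_exp_five`: PROP. 24.7 at the two levels).

Consumed by `IntegerScrewTiltPricing`.
RH-free, elementary.  Nothing in this file bears on the truth of RH.
References: CONTINUUM-LIMIT §25–26 (rh-explicit A6-PIVOT); M. Suzuki, J. Lond. Math. Soc. (2) 108 (2023)
1448–1487 [Suzuki2023] for the screw matrices this serves.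
-/

noncomputable section

set_option linter.dupNamespace false -- D-0017: `Summit.<S>.<S>.…` is the designed namespace

namespace Summit.RiemannHypothesis.RiemannHypothesis.Theorems.IntegerScrew

open Finset Real
open ArithmeticFunction (vonMangoldt)

/-! ### A bracket is a scaled window functional -/

/-- `Σ_{b≤Q} f = Σ_{b≤θ} f + Σ_{θ<b≤Q} f` for `θ ≤ Q`. -/
theorem sum_Icc_eq_sum_Icc_add_sum_Ioc (f : ℕ → ℝ) {θ Q : ℕ} (hθQ : θ ≤ Q) :
    ∑ b ∈ Icc 1 Q, f b = ∑ b ∈ Icc 1 θ, f b + ∑ b ∈ Ioc θ Q, f b := by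
  have hdisj : Disjoint (Icc 1 θ) (Ioc θ Q) := by
    rw [Finset.disjoint_left]; intro x hx hx'
    simp only [Finset.mem_Icc] at hx; simp only [Finset.mem_Ioc] at hx'; omega
  have hun : Icc 1 Q = Icc 1 θ ∪ Ioc θ Q := by
    ext x; simp only [Finset.mem_union, Finset.mem_Icc, Finset.mem_Ioc]; omega
  rw [hun, Finset.sum_union hdisj]

/-- **`Br(θ) = (H_θ/H_Q)·WF_θ`**: with `H_θ = Σ_{b≤θ}1/b`, `G(θ) = Σ_{b≤θ} g(b)/b` and `c_θ = exitMassRatio Q θ`,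
`H_θ·G(Q)/H_Q − G(θ) = (H_θ/H_Q)·(Σ_{θ<x≤Q} g(x)/x − c_θ·G(θ))` (`1 ≤ θ ≤ Q`). -/
theorem bracket_eq_mul_windowFunctional (g : ℕ → ℝ) {θ Q : ℕ} (hθ : 1 ≤ θ) (hθQ : θ ≤ Q) :
    (∑ b ∈ Icc 1 θ, (1 : ℝ) / b) * (∑ b ∈ Icc 1 Q, g b / b) / (∑ b ∈ Icc 1 Q, (1 : ℝ) / b) -
        ∑ b ∈ Icc 1 θ, g b / b =
      (∑ b ∈ Icc 1 θ, (1 : ℝ) / b) / (∑ b ∈ Icc 1 Q, (1 : ℝ) / b) *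
        (∑ x ∈ Ioc θ Q, g x / x - exitMassRatio Q θ * ∑ b ∈ Icc 1 θ, g b / b) := by
  have hHθ : 0 < ∑ b ∈ Icc 1 θ, (1 : ℝ) / b :=
    Finset.sum_pos (fun b hb => by have := (Finset.mem_Icc.1 hb).1; positivity) ⟨1, by simp [hθ]⟩
  have hHQ : 0 < ∑ b ∈ Icc 1 Q, (1 : ℝ) / b :=
    Finset.sum_pos (fun b hb => by have := (Finset.mem_Icc.1 hb).1; positivity) ⟨1, by simp; omega⟩
  have hH := sum_Icc_eq_sum_Icc_add_sum_Ioc (fun b => (1 : ℝ) / b) hθQ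
  have hG := sum_Icc_eq_sum_Icc_add_sum_Ioc (fun b => g b / b) hθQ
  unfold exitMassRatio
  rw [hH, hG]
  field_simp
  ring

/-! ### The bracket bound from THEOREM A -/

/-- `log(Q+1) ≤ H_Q` (Mathlib's `log_add_one_le_harmonic`). -/
theorem log_succ_le_sum_Icc_inv (Q : ℕ) : Real.log ((Q : ℝ) + 1) ≤ ∑ b ∈ Icc 1 Q, (1 : ℝ) / b := by
  have h := log_add_one_le_harmonic Q
  rw [harmonic_eq_sum_Icc, Rat.cast_sum] at h
  simpa [one_div] using h

/-- `log(θ+1) ≤ log θ + 1/θ` for `θ ≥ 1`. -/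
theorem log_succ_le_log_add_inv {θ : ℕ} (hθ : 1 ≤ θ) :
    Real.log ((θ : ℝ) + 1) ≤ Real.log θ + 1 / θ := by
  have hθ0 : (0 : ℝ) < θ := by exact_mod_cast (show 0 < θ by omega)
  have h : Real.log (((θ : ℝ) + 1) / θ) ≤ ((θ : ℝ) + 1) / θ - 1 := Real.log_le_sub_one_of_pos (by positivity)
  rw [Real.log_div (by positivity) hθ0.ne'] at h
  have : ((θ : ℝ) + 1) / θ - 1 = 1 / θ := by
    field_simp
    ring
  linarith

/-- **The bracket bound from THEOREM A**: for `149 ≤ θ`, `2θ ≤ Q` and every `g`,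
`Br(θ)² ≤ 304500·(log Q/log(θ+1))·D_Q(g)`.
(`Br² = (H_θ/H_Q)²·WF² ≤ ((1 + log θ)/log(Q+1))²·210000·(log Q/log θ)²·D_Q ≤ 302400·D_Q`, `t = log θ ≥ 5`:
after the scaling the window constant is BOUNDED; the stated form keeps the harmless factor `log Q/log(θ+1) ≥ 1`.) -/
theorem bracket_sq_le_theoremA (g : ℕ → ℝ) {θ Q : ℕ} (hθ : 149 ≤ θ) (hθQ : 2 * θ ≤ Q) :
    ((∑ b ∈ Icc 1 θ, (1 : ℝ) / b) * (∑ b ∈ Icc 1 Q, g b / b) / (∑ b ∈ Icc 1 Q, (1 : ℝ) / b) -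
        ∑ b ∈ Icc 1 θ, g b / b) ^ 2 ≤
      304500 * (Real.log Q / Real.log ((θ : ℝ) + 1)) *
        ∑ x ∈ Icc 1 Q, (1 / (x : ℝ)) * ∑ n ∈ x.divisors, vonMangoldt n * (g x - g (x / n)) ^ 2 := by
  set D := ∑ x ∈ Icc 1 Q, (1 / (x : ℝ)) * ∑ n ∈ x.divisors, vonMangoldt n * (g x - g (x / n)) ^ 2 with hD
  have hDnn : 0 ≤ D := Finset.sum_nonneg fun x _ => mul_nonneg (by positivity)
    (Finset.sum_nonneg fun n _ => mul_nonneg ArithmeticFunction.vonMangoldt_nonneg (sq_nonneg _))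
  set Hθ := ∑ b ∈ Icc 1 θ, (1 : ℝ) / b with hHθ
  set HQ := ∑ b ∈ Icc 1 Q, (1 : ℝ) / b with hHQ
  set t := Real.log (θ : ℝ) with ht
  set a := Real.log ((θ : ℝ) + 1) with ha
  set ℓ := Real.log (Q : ℝ) with hℓ
  -- numerical facts
  have hθ1 : 1 ≤ θ := by omega
  have hθr : (149 : ℝ) ≤ θ := by exact_mod_cast hθ
  have ht5 : 5 ≤ t := by
    have := five_le_log_succ (show 148 ≤ θ - 1 by omega)
    have hc : ((θ - 1 : ℕ) : ℝ) + 1 = θ := by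
      rw [Nat.cast_sub hθ1]; push_cast; ring
    rw [hc] at this; exact this
  have hta : t ≤ a := Real.log_le_log (by positivity) (by linarith)
  have ha0 : 0 < a := by linarith
  have hQr : (2 : ℝ) * θ ≤ Q := by exact_mod_cast hθQ
  have haℓ : a ≤ ℓ := Real.log_le_log (by positivity) (by linarith)
  have hℓ1 : ℓ ≤ Real.log ((Q : ℝ) + 1) := Real.log_le_log (by linarith) (by linarith)
  have hHθ_le : Hθ ≤ 1 + t := sum_Icc_inv_le_one_add_log θ
  have hHQ_ge : Real.log ((Q : ℝ) + 1) ≤ HQ := log_succ_le_sum_Icc_inv Q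
  have hHθ0 : 0 < Hθ :=
    Finset.sum_pos (fun b hb => by have := (Finset.mem_Icc.1 hb).1; positivity) ⟨1, by simp [hθ1]⟩
  have hHQ0 : 0 < HQ := by linarith
  -- THEOREM A on the window (θ, Q]
  have hA := theoremA (show 148 ≤ θ by omega) hθQ g
  rw [← hD] at hA
  -- Br = (Hθ/HQ)·WF
  rw [bracket_eq_mul_windowFunctional g hθ1 (by omega), mul_pow]
  set WF := ∑ x ∈ Ioc θ Q, g x / x - exitMassRatio Q θ * ∑ b ∈ Icc 1 θ, g b / b with hWF
  -- (Hθ/HQ)² ≤ ((1+t)/ℓ)²… we use (Hθ/HQ)² ≤ (1+t)²/ℓ_1² ≤ (1+t)²/ℓ²?  No: HQ ≥ log(Q+1) ≥ ℓ, so (Hθ/HQ)² ≤ (1+t)²/ℓ².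
  have hℓ0 : 0 < ℓ := by linarith
  have hratio : (Hθ / HQ) ^ 2 ≤ ((1 + t) / ℓ) ^ 2 := by
    have h1 : Hθ / HQ ≤ (1 + t) / ℓ :=
      calc Hθ / HQ ≤ (1 + t) / HQ := div_le_div_of_nonneg_right hHθ_le hHQ0.le
        _ ≤ (1 + t) / ℓ := div_le_div_of_nonneg_left (by linarith) hℓ0 (by linarith)
    exact pow_le_pow_left₀ (by positivity) h1 2
  -- the numerical heart: ((1+t)/ℓ)²·210000·(ℓ/t)³ ≤ 304500·ℓ/a, i.e. 210000(1+t)²·a ≤ 304500·t³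
  have ht0 : 0 < t := by linarith
  have hnum : ((1 + t) / ℓ) ^ 2 * (210000 * (ℓ / t) ^ 2) ≤ 304500 * (ℓ / a) := by
    have e : ((1 + t) / ℓ) ^ 2 * (210000 * (ℓ / t) ^ 2) = 210000 * ((1 + t) / t) ^ 2 := by
      field_simp
    rw [e]
    -- 210000·((1+t)/t)² ≤ 210000·(6/5)² = 302400 ≤ 304500 ≤ 304500·(ℓ/a)
    have h1 : (1 + t) / t ≤ 6 / 5 := by rw [div_le_iff₀ ht0]; linarith
    have h2 : ((1 + t) / t) ^ 2 ≤ (6 / 5) ^ 2 := pow_le_pow_left₀ (by positivity) h1 2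
    have h3 : 1 ≤ ℓ / a := by rw [le_div_iff₀ ha0]; linarith
    nlinarith
  calc (Hθ / HQ) ^ 2 * WF ^ 2 ≤ (Hθ / HQ) ^ 2 * (210000 * (ℓ / t) ^ 2 * D) :=
        mul_le_mul_of_nonneg_left hA (by positivity)
    _ = (Hθ / HQ) ^ 2 * (210000 * (ℓ / t) ^ 2) * D := by ring
    _ ≤ ((1 + t) / ℓ) ^ 2 * (210000 * (ℓ / t) ^ 2) * D :=
        mul_le_mul_of_nonneg_right (mul_le_mul_of_nonneg_right hratio (by positivity)) hDnn
    _ ≤ 304500 * (ℓ / a) * D := mul_le_mul_of_nonneg_right hnum hDnn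

/-! ### The crude bracket bound (PROP. 24.7 twice) -/

/-- For `149 ≤ Q` and `1 ≤ θ ≤ Q`: `Br(θ)² ≤ (33·log Q)²·D_Q(g)` (`bracket_sq_le_dirichlet_exp_five` with
`H_θ²/H_Q ≤ H_θ ≤ 1 + log Q ≤ (6/5)log Q`, `⌊log₂θ⌋ ≤ ⌊log₂Q⌋ ≤ log Q/log 2`, `4e⁵·(6/5)/log 2 ≤ 33²`). -/
theorem bracket_sq_le_crude (g : ℕ → ℝ) {θ Q : ℕ} (hQ : 149 ≤ Q) (hθ : 1 ≤ θ) (hθQ : θ ≤ Q) :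
    ((∑ b ∈ Icc 1 θ, (1 : ℝ) / b) * (∑ b ∈ Icc 1 Q, g b / b) / (∑ b ∈ Icc 1 Q, (1 : ℝ) / b) -
        ∑ b ∈ Icc 1 θ, g b / b) ^ 2 ≤
      (33 * Real.log Q) ^ 2 *
        ∑ x ∈ Icc 1 Q, (1 / (x : ℝ)) * ∑ n ∈ x.divisors, vonMangoldt n * (g x - g (x / n)) ^ 2 := by
  set D := ∑ x ∈ Icc 1 Q, (1 / (x : ℝ)) * ∑ n ∈ x.divisors, vonMangoldt n * (g x - g (x / n)) ^ 2 with hD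
  have hDnn : 0 ≤ D := Finset.sum_nonneg fun x _ => mul_nonneg (by positivity)
    (Finset.sum_nonneg fun n _ => mul_nonneg ArithmeticFunction.vonMangoldt_nonneg (sq_nonneg _))
  have h := bracket_sq_le_dirichlet_exp_five g hθ hθQ
  rw [← hD] at h
  set Hθ := ∑ b ∈ Icc 1 θ, (1 : ℝ) / b with hHθ
  set HQ := ∑ b ∈ Icc 1 Q, (1 : ℝ) / b with hHQ
  set ℓ := Real.log (Q : ℝ) with hℓ
  have hl2 := Real.log_two_gt_d9
  have hQr : (149 : ℝ) ≤ Q := by exact_mod_cast hQ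
  have hℓ5 : 5 ≤ ℓ := by
    have := five_le_log_succ (show 148 ≤ Q - 1 by omega)
    have hc : ((Q - 1 : ℕ) : ℝ) + 1 = Q := by
      rw [Nat.cast_sub (by omega : 1 ≤ Q)]; push_cast; ring
    rw [hc] at this; exact this
  have hℓ0 : 0 < ℓ := by linarith
  have hHθ0 : 0 < Hθ :=
    Finset.sum_pos (fun b hb => by have := (Finset.mem_Icc.1 hb).1; positivity) ⟨1, by simp [hθ]⟩
  have hHθQ : Hθ ≤ HQ :=
    Finset.sum_le_sum_of_subset_of_nonneg (Finset.Icc_subset_Icc_right hθQ) fun b _ _ => by positivity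
  have hHQ0 : 0 < HQ := lt_of_lt_of_le hHθ0 hHθQ
  have hHQ_le : HQ ≤ 1 + ℓ := sum_Icc_inv_le_one_add_log Q
  have hHθ_le : Hθ ≤ 6 / 5 * ℓ := by linarith
  -- Hθ²/HQ ≤ Hθ
  have h1 : Hθ ^ 2 * (Nat.log 2 Q : ℝ) / HQ ≤ Hθ * (Nat.log 2 Q : ℝ) := by
    rw [div_le_iff₀ hHQ0]
    have : Hθ ^ 2 * (Nat.log 2 Q : ℝ) ≤ Hθ * HQ * (Nat.log 2 Q : ℝ) :=
      mul_le_mul_of_nonneg_right (by nlinarith) (Nat.cast_nonneg _)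
    linarith
  -- ⌊log₂θ⌋ ≤ ⌊log₂Q⌋ ≤ ℓ/log 2 ≤ 1.443 ℓ
  have hNQ : (Nat.log 2 Q : ℝ) ≤ 1.443 * ℓ := by
    have h := natLog_two_le_log_div (show 1 ≤ Q by omega)
    have h' : Real.log Q / Real.log 2 ≤ 1.443 * ℓ := by
      rw [div_le_iff₀ (by linarith)]
      have : 0 ≤ ℓ * (1.443 * Real.log 2 - 1) := mul_nonneg hℓ0.le (by linarith)
      linarith
    exact h.trans h'
  have hNθ : (Nat.log 2 θ : ℝ) ≤ 1.443 * ℓ := by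
    have : (Nat.log 2 θ : ℝ) ≤ Nat.log 2 Q := by exact_mod_cast Nat.log_mono_right hθQ
    exact this.trans hNQ
  have he := exp_five_lt
  have he0 : 0 < Real.exp 5 := Real.exp_pos 5
  -- assemble: 2e⁵(Hθ²N_Q/HQ + Hθ N_θ) ≤ 2·148.42·(2·(6/5)ℓ·1.443ℓ) ≤ 1089 ℓ²
  have hin : Hθ ^ 2 * (Nat.log 2 Q : ℝ) / HQ + Hθ * (Nat.log 2 θ : ℝ) ≤ 2 * (6 / 5 * ℓ) * (1.443 * ℓ) := by
    have e1 : Hθ * (Nat.log 2 Q : ℝ) ≤ (6 / 5 * ℓ) * (1.443 * ℓ) :=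
      mul_le_mul hHθ_le hNQ (Nat.cast_nonneg _) (by positivity)
    have e2 : Hθ * (Nat.log 2 θ : ℝ) ≤ (6 / 5 * ℓ) * (1.443 * ℓ) :=
      mul_le_mul hHθ_le hNθ (Nat.cast_nonneg _) (by positivity)
    linarith
  have hin0 : 0 ≤ Hθ ^ 2 * (Nat.log 2 Q : ℝ) / HQ + Hθ * (Nat.log 2 θ : ℝ) := by positivity
  calc _ ≤ 2 * Real.exp 5 * (Hθ ^ 2 * (Nat.log 2 Q : ℝ) / HQ + Hθ * (Nat.log 2 θ : ℝ)) * D := h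
    _ ≤ 2 * 148.42 * (2 * (6 / 5 * ℓ) * (1.443 * ℓ)) * D := by
        refine mul_le_mul_of_nonneg_right ?_ hDnn
        exact mul_le_mul (by nlinarith) hin hin0 (by positivity)
    _ ≤ (33 * ℓ) ^ 2 * D := by
        refine mul_le_mul_of_nonneg_right ?_ hDnn
        nlinarith [sq_nonneg ℓ]

end Summit.RiemannHypothesis.RiemannHypothesis.Theorems.IntegerScrew

end
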